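import Summits.KontsevichZagierPeriods.Zeta5Search.LaiSweepShard

/-!
# `κ₃` sweep certificate — shard file 066 of 127 (shards 462–468 of 889)

HONEST FRAMING. Systematic search; no irrationality claim unless certified. This file only checks,
by `decide +kernel`, shards 462–468 of the order-cell sweep of the `κ₃` point `(74, 2180, 444; δ74)`
(engine `LaiSweepEngine`, soundness `LaiSweepJump/Free/Eval/Shard/Kappa3`; a shard is `⟨regime, n,
p, q, p', q', Lo, Up⟩`: `n` cells from `p/q` to `p'/q'` with integer rate sums in `[Lo, Up]`, `K =
128`, `D = 2^40`). It draws NO conclusion: only the capstone `LaiKappa3SweepCert`, which needs all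
127 shard files, does. Kernel cost of this file ≈ 560 cells × 0.3 s.
-/

namespace Summit.KontsevichZagierPeriods.Zeta5Search.Sweep

set_option maxHeartbeats 100000000 in
/-- Shard 462: 80 cells of regime B from `44/95` to `137/295`.
[cite: Lai2024BallRivoal, §4 Lemma 4.3] -/
theorem shard462 :
    Shard.check 128 (2^40)
      ⟨true, 80, 44, 95, 137, 295, 15794044139415, 18730071215818⟩ = true := by
  decide +kernel

set_option maxHeartbeats 100000000 in
/-- Shard 463: 80 cells of regime B from `137/295` to `2237/4804`.
[cite: Lai2024BallRivoal, §4 Lemma 4.3] -/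
theorem shard463 :
    Shard.check 128 (2^40)
      ⟨true, 80, 137, 295, 2237, 4804, 15740738849882, 18683446068352⟩ = true := by
  decide +kernel

set_option maxHeartbeats 100000000 in
/-- Shard 464: 80 cells of regime B from `2237/4804` to `113/242`.
[cite: Lai2024BallRivoal, §4 Lemma 4.3] -/
theorem shard464 :
    Shard.check 128 (2^40)
      ⟨true, 80, 2237, 4804, 113, 242, 16239400253611, 19293514961490⟩ = true := by
  decide +kernel

set_option maxHeartbeats 100000000 in
/-- Shard 465: 80 cells of regime B from `113/242` to `184/393`.
[cite: Lai2024BallRivoal, §4 Lemma 4.3] -/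
theorem shard465 :
    Shard.check 128 (2^40)
      ⟨true, 80, 113, 242, 184, 393, 15741144596884, 18718057231788⟩ = true := by
  decide +kernel

set_option maxHeartbeats 100000000 in
/-- Shard 466: 80 cells of regime B from `184/393` to `123/262`.
[cite: Lai2024BallRivoal, §4 Lemma 4.3] -/
theorem shard466 :
    Shard.check 128 (2^40)
      ⟨true, 80, 184, 393, 123, 262, 15966209170739, 19003029341659⟩ = true := by
  decide +kernel

set_option maxHeartbeats 100000000 in
/-- Shard 467: 80 cells of regime B from `123/262` to `153/325`.
[cite: Lai2024BallRivoal, §4 Lemma 4.3] -/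
theorem shard467 :
    Shard.check 128 (2^40)
      ⟨true, 80, 123, 262, 153, 325, 16307241149490, 19427362017874⟩ = true := by
  decide +kernel

set_option maxHeartbeats 100000000 in
/-- Shard 468: 80 cells of regime B from `153/325` to `101/214`.
[cite: Lai2024BallRivoal, §4 Lemma 4.3] -/
theorem shard468 :
    Shard.check 128 (2^40)
      ⟨true, 80, 153, 325, 101, 214, 14913488090180, 17782568377932⟩ = true := by
  decide +kernel

/-- The checked shards of this file, in order. [folklore] -/
def shards066 : List (CheckedShard 128 (2^40)) :=
  [⟨_, shard462⟩, ⟨_, shard463⟩, ⟨_, shard464⟩, ⟨_, shard465⟩, ⟨_, shard466⟩,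
    ⟨_, shard467⟩, ⟨_, shard468⟩]

end Summit.KontsevichZagierPeriods.Zeta5Search.Sweep
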